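import Literature.MathematicalPhysics.QuantumFieldTheory.Balaban1983to89.Node00.DomainsRefinementNonlinear
import Literature.MathematicalPhysics.QuantumFieldTheory.Balaban1983to89.Node00.DomainsMeet
import Literature.MathematicalPhysics.QuantumFieldTheory.Balaban1983to89.Node00.DomainsOfSeq
import Summits.QuantumFields.YangMills.Theorems.BalabanUVNodesN07CritLamSurgery
import Summits.QuantumFields.YangMills.Theorems.BalabanUVNodesK0Stub1CritOnFibreGaugeCovariance
import HarnessLib

/-!
# N07 [B11] ∕ K0⁷ road, chart side — MODULE 103: **PRINT'S CRITICALITY OF THE RECORD'S MINIMISER, TRANSPORTED TO THE PER-CUBE MEET FAMILY AND TO THE GLOBALLY READ CHART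
# CONFIGURATION** — gauge copy ∘ refinement (MODULE 101) ∘ truncation ∘ surgery (MODULE 102): the (d′) in-edge of the K0 road in the cell form, with the tower geometry displayed

Cell `pub-ymgap`, seat `pub-ymgap-dag-n07-e` g29 (FAN-OUT §N07 row s3; LANE OWNER of the K0 road chart side), MODULE 103 = repair (R2)(c) of ⚑ LOCATED-DPRIME-CALIBRATION.
`--kind proof --supports stmt-QuantumFields-20541 --as helper` (K0⁷); count-neutral; theorems only.  [15] = [Balaban1985Variational]; [B6] = [Balaban1984PropagatorsII];
[B7] = [Balaban1985Averaging]; [III] = [Balaban1988Convergent].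

WHY.  The supplier of the (d′) letter (k0-s1 S4, to be re-cut in cell form per the memo's (R1)) asks the charted configuration `Ũ` — read on EVERY bond of the torus — to be
curve-critical on the fibre of the per-cube family `HVd = cubeDomains ⊓ domainsOfSeq s.Ω k′` (`k′ = K − n`) through its own averages.  What the record supplies (after the reading
repair, memo (R4)) is print's criticality of the minimiser `U` on the (2.3) fibre of the WHOLE sequence family `domainsOfSeq s.Ω k`.  The transport is four by-name steps: (1) gauge
copy `U ↦ U^u` ([B7] (11)–(13): `iter_gaugeAct`, `wilsonAction4_gaugeAct'`, k0-s1-w1's bookkeeping, here in the cell form); (2) truncation `domainsOfSeq s.Ω k′ ≤ domainsOfSeq s.Ω k`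
levelwise for `k′ ≤ k` (§1) and `HVd ≤ domainsOfSeq s.Ω k′` (MODULE 44B `domainsMeet_le_right`); (3) refinement shrinks the fibre (MODULE 101 `critLam_of_domainsLe`); (4) surgery at
the pinned level-0 cells (MODULE 102 `critLam_surgery`: `Ũ = U^u` on the collar region `R₀`, every bond off `R₁` pinned, plaquettes meeting `R₁` inside `R₀`, cells fed inside `R₀` or
off `R₁`).  The three geometric clauses of (4) are DISPLAYED here (their discharge at the tower `□₀ ⊃ □₁`, `R₀ = (regionOfSet (π″□₀)).bonds`, is the next module).

WHAT IS PROVED (sorry-free; no definition; axioms standard).  §1 `domainsOfSeq_Om_subset_of_le` (truncating the sequence family at a lower top level refines nothing away below it: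
`Ω_j^{(j)}[k′] ⊆ Ω_j^{(j)}[k]` for `k′ ≤ k`), `domainsMeet_seq_le_seq`.  §2 ★★ `critLam_gaugeAct` (print's curve-criticality on a (2.3) fibre is gauge-covariant, cell form; data
transported by the block-centre tower `transfUp u`), `critLam_gaugeAct_avgFamily` (own-averages form).  §3 ★★★ `critLam_meet_gaugeAct_of_critLam_seq` ((1)∘(2)∘(3): print-critical on
`domainsOfSeq Ω k` ⇒ `U^u` print-critical on every `D₁ ⊓ domainsOfSeq Ω k′`, `k′ ≤ k`, through its own averages), ★★★ `critLam_meet_of_critLam_seq_of_eqOn` ((1)∘(2)∘(3)∘(4): the same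
for ANY `Ũ` agreeing with `U^u` on `R₀`, under the three displayed clauses).
HONEST FRAMING: by-name composition; NOTHING of [15]'s estimates asserted; the reading seam (b)∕(ii) is NOT touched (the input is print's cell-form criticality, memo (R4)); (d′) ∕
`HThm4RecDbar` ∕ budget row of MODULE 100 untouched; K0⁷ NOT closed; N07 NOT discharged; counts unmoved; one finite 𝕋⁴ programme at fixed ε — NOT continuum ∕ ℝ⁴ ∕ OS ∕ mass gap ∕ Clay.
No `sorry`, no `def`, no `instance`, no `notation`.

References: [15] (5)–(6) p.278, (144) p.300, (147)–(153) p.301, Prop. 8 p.304; [B6] (2.1)–(2.3) p.224; [B7] (11)–(13) p.19; [III] (2.1)–(2.2) pp.254–255, (2.10)–(2.12) p.256.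
-/

set_option autoImplicit false

noncomputable section

open scoped Matrix.Norms.L2Operator Topology BigOperators
open Filter

namespace Summit.QuantumFields.YangMills.BalabanUVNodes.N07CritLamTransferMeet

open Literature.MathematicalPhysics.QuantumFieldTheory.Balaban1983to89
open Literature.MathematicalPhysics.QuantumFieldTheory.Balaban1983to89.T4Continuum (T4Family transfUp iter_gaugeAct)
open Literature.MathematicalPhysics.QuantumFieldTheory.Balaban1983to89.B15DeterminingSets
open Literature.MathematicalPhysics.QuantumFieldTheory.Balaban1983to89.B5Eq118OneStroke (iterBlockOf)
open Literature.MathematicalPhysics.QuantumFieldTheory.Balaban1983to89.B6SectADomainsV1 (Domains)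
open Literature.MathematicalPhysics.QuantumFieldTheory.Balaban1983to89.B14.Eq216Concrete (feeds)
open Literature.MathematicalPhysics.QuantumFieldTheory.Balaban1983to89.Node00
open Summit.QuantumFields.YangMills.Theorems.K0Stub1CritOnFibreGaugeCovariance (differentiableAt_coe_gaugeAct_const)
open Summit.QuantumFields.YangMills.BalabanUVNodes.N07CritLamSurgery (critLam_surgery)

/-! ## §1  Truncation of the sequence family at a lower top level -/

section Truncation

variable {P : Params}

/-- `Ω_j^{(j)}` of `domainsOfSeq Ω k′` is contained in `Ω_j^{(j)}` of `domainsOfSeq Ω k` for `k′ ≤ k` (same membership test below `k′`, empty above). [cite: Balaban1988Convergent, (2.1)–(2.2) pp.254–255] -/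
theorem domainsOfSeq_Om_subset_of_le (Ω : ℕ → Set (Site P 0)) {k' k : ℕ} (hk'k : k' ≤ k) (hk' : k' ≤ P.m + P.K) (hk : k ≤ P.m + P.K) (j : ℕ) :
    (domainsOfSeq Ω k' hk').Om j ⊆ (domainsOfSeq Ω k hk).Om j := by
  intro y hy
  rcases le_or_gt j k' with hj | hj
  · rw [mem_domainsOfSeq_Om_iff Ω hk' hj] at hy
    rw [mem_domainsOfSeq_Om_iff Ω hk (hj.trans hk'k)]
    exact hy
  · rw [domainsOfSeq_Om_of_gt Ω hk' hj] at hy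
    exact absurd hy (Finset.notMem_empty _)

/-- The per-cube meet `D₁ ⊓ domainsOfSeq Ω k′` refines the whole sequence family `domainsOfSeq Ω k`, `k′ ≤ k`. [cite: Balaban1985Variational, (150) p.301; Balaban1988Convergent, (2.1) p.254] -/
theorem domainsMeet_seq_le_seq (D₁ : Domains P) (Ω : ℕ → Set (Site P 0)) {k' k : ℕ} (hk'k : k' ≤ k) (hk' : k' ≤ P.m + P.K) (hk : k ≤ P.m + P.K) :
    ∀ j : ℕ, (domainsMeet D₁ (domainsOfSeq Ω k' hk')).Om j ⊆ (domainsOfSeq Ω k hk).Om j :=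
  fun j => (domainsMeet_le_right D₁ _ j).trans (domainsOfSeq_Om_subset_of_le Ω hk'k hk' hk j)

end Truncation

/-! ## §2  Print's curve-criticality on a (2.3) fibre is gauge-covariant (cell form) -/

section Gauge

variable {F : T4Family} {N : ℕ} [NeZero N] {K : ℕ}

/-- ★★ **GAUGE COVARIANCE, CELL FORM**: if `U` is curve-critical on the `D`-fibre of `W` then `u • U` is curve-critical on the `D`-fibre of the transported datum
`j ↦ (transfUp u j) • W_j` — pull a curve back by `u⁻¹` ([B7] (11)–(13); k0-s1-w1's `isCritOnFibre_gaugeAct` in the (2.3) letters). [cite: Balaban1985Averaging, (11)–(13) p.19; Balaban1985Variational, (5)–(6) p.278; Balaban1984PropagatorsII, (2.3) p.224] -/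
theorem critLam_gaugeAct (D : Domains (F.P K)) {W : MSField (F.P K) (SU N)} {U : GaugeField (F.P K) 0 (SU N)} (u : GaugeTransf (F.P K) 0 (SU N))
    (hcrit : ∀ γ : ℝ → GaugeField (F.P K) 0 (SU N), γ 0 = U →
      DifferentiableAt ℝ (fun (t : ℝ) (b : PBond (F.P K) 0) => ((γ t b : SU N) : Matrix (Fin N) (Fin N) ℂ)) 0 →
        (∀ᶠ t in 𝓝 (0 : ℝ), ∀ (j : ℕ) (c : PBond (F.P K) j), D.LamBond j c → avgFamily (avOfRecord F N K) (γ t) j c = W j c) →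
          ∀ a : ℝ, HasDerivAt (fun t => wilsonAction4 (γ t)) a 0 → a = 0) :
    ∀ γ : ℝ → GaugeField (F.P K) 0 (SU N), γ 0 = GaugeField.gaugeAct u U →
      DifferentiableAt ℝ (fun (t : ℝ) (b : PBond (F.P K) 0) => ((γ t b : SU N) : Matrix (Fin N) (Fin N) ℂ)) 0 →
        (∀ᶠ t in 𝓝 (0 : ℝ), ∀ (j : ℕ) (c : PBond (F.P K) j), D.LamBond j c →
          avgFamily (avOfRecord F N K) (γ t) j c = GaugeField.gaugeAct (transfUp u j) (W j) c) →
          ∀ a : ℝ, HasDerivAt (fun t => wilsonAction4 (γ t)) a 0 → a = 0 := by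
  intro γ hγ0 hγd hγfib a ha
  -- the pulled-back curve
  set γ' : ℝ → GaugeField (F.P K) 0 (SU N) := fun t => GaugeField.gaugeAct (fun x => (u x)⁻¹) (γ t) with hγ'
  have hγ'0 : γ' 0 = U := by
    show GaugeField.gaugeAct (fun x => (u x)⁻¹) (γ 0) = U
    rw [hγ0]; funext b; simp [GaugeField.gaugeAct, mul_assoc]
  have hγ'd : DifferentiableAt ℝ (fun (t : ℝ) (b : PBond (F.P K) 0) => ((γ' t b : SU N) : Matrix (Fin N) (Fin N) ℂ)) 0 :=
    differentiableAt_coe_gaugeAct_const (fun x => (u x)⁻¹) hγd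
  have hγ'fib : ∀ᶠ t in 𝓝 (0 : ℝ), ∀ (j : ℕ) (c : PBond (F.P K) j), D.LamBond j c → avgFamily (avOfRecord F N K) (γ' t) j c = W j c := by
    filter_upwards [hγfib] with t ht j c hc
    have hj : j ≤ (F.P K).m + (F.P K).K := (D.le_of_lamBond hc).trans D.hk
    have e : avgFamily (avOfRecord F N K) (γ' t) j = GaugeField.gaugeAct (transfUp (fun x => (u x)⁻¹) j) (avgFamily (avOfRecord F N K) (γ t) j) :=
      iter_gaugeAct (avOfRecord F N K) (fun x => (u x)⁻¹) j hj (γ t)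
    rw [e]
    show transfUp (fun x => (u x)⁻¹) j c.src * avgFamily (avOfRecord F N K) (γ t) j c * (transfUp (fun x => (u x)⁻¹) j c.tgt)⁻¹ = W j c
    rw [ht j c hc, Summit.QuantumFields.YangMills.Theorems.K0Stub1CritOnFibreGaugeCovariance.transfUp_inv]
    rw [Summit.QuantumFields.YangMills.Theorems.K0Stub1CritOnFibreGaugeCovariance.transfUp_inv]
    simp [GaugeField.gaugeAct, mul_assoc]
  have hA : (fun t => wilsonAction4 (γ' t)) = fun t => wilsonAction4 (γ t) :=
    funext fun t => B14Eq16FaddeevPopov.wilsonAction4_gaugeAct' (fun x => (u x)⁻¹) (γ t)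
  exact hcrit γ' hγ'0 hγ'd hγ'fib a (by rw [hA]; exact ha)

/-- **Own-averages form**: if `U` is curve-critical on the `D`-fibre of `W` and lies on it, then `u • U` is curve-critical on the `D`-fibre of ITS OWN averages `Ū(u • U)`.
[cite: Balaban1985Averaging, (11)–(13) p.19; Balaban1985Variational, (5)–(6) p.278] -/
theorem critLam_gaugeAct_avgFamily (D : Domains (F.P K)) {W : MSField (F.P K) (SU N)} {U : GaugeField (F.P K) 0 (SU N)} (u : GaugeTransf (F.P K) 0 (SU N))
    (hUW : ∀ (j : ℕ) (c : PBond (F.P K) j), D.LamBond j c → avgFamily (avOfRecord F N K) U j c = W j c)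
    (hcrit : ∀ γ : ℝ → GaugeField (F.P K) 0 (SU N), γ 0 = U →
      DifferentiableAt ℝ (fun (t : ℝ) (b : PBond (F.P K) 0) => ((γ t b : SU N) : Matrix (Fin N) (Fin N) ℂ)) 0 →
        (∀ᶠ t in 𝓝 (0 : ℝ), ∀ (j : ℕ) (c : PBond (F.P K) j), D.LamBond j c → avgFamily (avOfRecord F N K) (γ t) j c = W j c) →
          ∀ a : ℝ, HasDerivAt (fun t => wilsonAction4 (γ t)) a 0 → a = 0) :
    ∀ γ : ℝ → GaugeField (F.P K) 0 (SU N), γ 0 = GaugeField.gaugeAct u U →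
      DifferentiableAt ℝ (fun (t : ℝ) (b : PBond (F.P K) 0) => ((γ t b : SU N) : Matrix (Fin N) (Fin N) ℂ)) 0 →
        (∀ᶠ t in 𝓝 (0 : ℝ), ∀ (j : ℕ) (c : PBond (F.P K) j), D.LamBond j c →
          avgFamily (avOfRecord F N K) (γ t) j c = avgFamily (avOfRecord F N K) (GaugeField.gaugeAct u U) j c) →
          ∀ a : ℝ, HasDerivAt (fun t => wilsonAction4 (γ t)) a 0 → a = 0 := by
  intro γ hγ0 hγd hγfib a ha
  refine critLam_gaugeAct D u hcrit γ hγ0 hγd (hγfib.mono fun t ht j c hc => ?_) a ha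
  have hj : j ≤ (F.P K).m + (F.P K).K := (D.le_of_lamBond hc).trans D.hk
  have e : avgFamily (avOfRecord F N K) (GaugeField.gaugeAct u U) j = GaugeField.gaugeAct (transfUp u j) (avgFamily (avOfRecord F N K) U j) :=
    iter_gaugeAct (avOfRecord F N K) u j hj U
  rw [ht j c hc, e]
  show transfUp u j c.src * avgFamily (avOfRecord F N K) U j c * (transfUp u j c.tgt)⁻¹ = transfUp u j c.src * W j c * (transfUp u j c.tgt)⁻¹
  rw [hUW j c hc]

end Gauge

/-! ## §3  The composition: gauge copy ∘ truncation ∘ refinement (∘ surgery) -/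

section Compose

variable {F : T4Family} {N : ℕ} [NeZero N] {K : ℕ}

/-- ★★★ **PRINT-CRITICAL ON THE WHOLE SEQUENCE FAMILY ⇒ THE GAUGE COPY IS PRINT-CRITICAL ON EVERY PER-CUBE MEET** `D₁ ⊓ domainsOfSeq Ω k′`, `k′ ≤ k`, through its own averages
(§2 ∘ §1 ∘ MODULE 101 `critLam_of_domainsLe`). [cite: Balaban1985Variational, (5)–(6) p.278, (150) p.301, Prop. 8 p.304; Balaban1984PropagatorsII, (2.3) p.224; Balaban1985Averaging, (11)–(13) p.19] -/
theorem critLam_meet_gaugeAct_of_critLam_seq (Ω : ℕ → Set (Site (F.P K) 0)) {k' k : ℕ} (hk'k : k' ≤ k) (hk' : k' ≤ (F.P K).m + (F.P K).K)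
    (hk : k ≤ (F.P K).m + (F.P K).K) (D₁ : Domains (F.P K)) {W : MSField (F.P K) (SU N)} {U : GaugeField (F.P K) 0 (SU N)}
    (u : GaugeTransf (F.P K) 0 (SU N))
    (hUW : ∀ (j : ℕ) (c : PBond (F.P K) j), (domainsOfSeq Ω k hk).LamBond j c → avgFamily (avOfRecord F N K) U j c = W j c)
    (hcrit : ∀ γ : ℝ → GaugeField (F.P K) 0 (SU N), γ 0 = U →
      DifferentiableAt ℝ (fun (t : ℝ) (b : PBond (F.P K) 0) => ((γ t b : SU N) : Matrix (Fin N) (Fin N) ℂ)) 0 →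
        (∀ᶠ t in 𝓝 (0 : ℝ), ∀ (j : ℕ) (c : PBond (F.P K) j), (domainsOfSeq Ω k hk).LamBond j c → avgFamily (avOfRecord F N K) (γ t) j c = W j c) →
          ∀ a : ℝ, HasDerivAt (fun t => wilsonAction4 (γ t)) a 0 → a = 0) :
    ∀ γ : ℝ → GaugeField (F.P K) 0 (SU N), γ 0 = GaugeField.gaugeAct u U →
      DifferentiableAt ℝ (fun (t : ℝ) (b : PBond (F.P K) 0) => ((γ t b : SU N) : Matrix (Fin N) (Fin N) ℂ)) 0 →
        (∀ᶠ t in 𝓝 (0 : ℝ), ∀ (j : ℕ) (c : PBond (F.P K) j), (domainsMeet D₁ (domainsOfSeq Ω k' hk')).LamBond j c →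
          avgFamily (avOfRecord F N K) (γ t) j c = avgFamily (avOfRecord F N K) (GaugeField.gaugeAct u U) j c) →
          ∀ a : ℝ, HasDerivAt (fun t => wilsonAction4 (γ t)) a 0 → a = 0 :=
  critLam_of_domainsLe (domainsMeet_seq_le_seq D₁ Ω hk'k hk' hk) (W := avgFamily (avOfRecord F N K) (GaugeField.gaugeAct u U)) (fun _ _ _ => rfl)
    (critLam_gaugeAct_avgFamily (domainsOfSeq Ω k hk) u hUW hcrit)

/-- ★★★ **… AND ON TO THE GLOBALLY READ CHART CONFIGURATION** (∘ MODULE 102 `critLam_surgery`): under the three displayed clauses of the tower geometry — every fine bond off `R₁`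
is a level-0 cell of the meet, every plaquette meeting `R₁` lies in `R₀`, every meet-cell is fed inside `R₀` or off `R₁` — ANY `Ũ` with `Ũ = u • U` on `R₀` (in use: `Ũ = e^{iηA}`
read on every bond, `R₀ = (regionOfSet (π″□₀)).bonds`, (T1) of the head token) is print-critical on the meet fibre through its own averages: the cell-form in-edge of the (d′) supplier.
[cite: Balaban1985Variational, (5)–(6) p.278, (144) p.300, (147)–(153) p.301, Prop. 8 p.304; Balaban1984PropagatorsII, (2.3) p.224; Balaban1988Convergent, (2.10)–(2.12) p.256] -/
theorem critLam_meet_of_critLam_seq_of_eqOn (Ω : ℕ → Set (Site (F.P K) 0)) {k' k : ℕ} (hk'k : k' ≤ k) (hk' : k' ≤ (F.P K).m + (F.P K).K)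
    (hk : k ≤ (F.P K).m + (F.P K).K) (D₁ : Domains (F.P K)) {R₀ R₁ : Set (PBond (F.P K) 0)}
    (hpin : ∀ b : PBond (F.P K) 0, b ∉ R₁ → (domainsMeet D₁ (domainsOfSeq Ω k' hk')).LamBond 0 b)
    (hcollar : ∀ p : Plaq (F.P K) 0,
      ((⟨p.src, p.μ⟩ : PBond (F.P K) 0) ∈ R₁ ∨ (⟨p.src.shift p.μ, p.ν⟩ : PBond (F.P K) 0) ∈ R₁ ∨
        (⟨p.src.shift p.ν, p.μ⟩ : PBond (F.P K) 0) ∈ R₁ ∨ (⟨p.src, p.ν⟩ : PBond (F.P K) 0) ∈ R₁) →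
      ((⟨p.src, p.μ⟩ : PBond (F.P K) 0) ∈ R₀ ∧ (⟨p.src.shift p.μ, p.ν⟩ : PBond (F.P K) 0) ∈ R₀ ∧
        (⟨p.src.shift p.ν, p.μ⟩ : PBond (F.P K) 0) ∈ R₀ ∧ (⟨p.src, p.ν⟩ : PBond (F.P K) 0) ∈ R₀))
    (hfeeds : ∀ (j : ℕ) (c : PBond (F.P K) j), (domainsMeet D₁ (domainsOfSeq Ω k' hk')).LamBond j c → feeds j c ⊆ R₀ ∨ Disjoint (feeds j c) R₁)
    {W : MSField (F.P K) (SU N)} {U Ut : GaugeField (F.P K) 0 (SU N)} (u : GaugeTransf (F.P K) 0 (SU N))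
    (hagree : ∀ b ∈ R₀, Ut b = GaugeField.gaugeAct u U b)
    (hUW : ∀ (j : ℕ) (c : PBond (F.P K) j), (domainsOfSeq Ω k hk).LamBond j c → avgFamily (avOfRecord F N K) U j c = W j c)
    (hcrit : ∀ γ : ℝ → GaugeField (F.P K) 0 (SU N), γ 0 = U →
      DifferentiableAt ℝ (fun (t : ℝ) (b : PBond (F.P K) 0) => ((γ t b : SU N) : Matrix (Fin N) (Fin N) ℂ)) 0 →
        (∀ᶠ t in 𝓝 (0 : ℝ), ∀ (j : ℕ) (c : PBond (F.P K) j), (domainsOfSeq Ω k hk).LamBond j c → avgFamily (avOfRecord F N K) (γ t) j c = W j c) →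
          ∀ a : ℝ, HasDerivAt (fun t => wilsonAction4 (γ t)) a 0 → a = 0) :
    ∀ γ : ℝ → GaugeField (F.P K) 0 (SU N), γ 0 = Ut →
      DifferentiableAt ℝ (fun (t : ℝ) (b : PBond (F.P K) 0) => ((γ t b : SU N) : Matrix (Fin N) (Fin N) ℂ)) 0 →
        (∀ᶠ t in 𝓝 (0 : ℝ), ∀ (j : ℕ) (c : PBond (F.P K) j), (domainsMeet D₁ (domainsOfSeq Ω k' hk')).LamBond j c →
          avgFamily (avOfRecord F N K) (γ t) j c = avgFamily (avOfRecord F N K) Ut j c) →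
          ∀ a : ℝ, HasDerivAt (fun t => wilsonAction4 (γ t)) a 0 → a = 0 :=
  critLam_surgery hpin hcollar hfeeds hagree (W := avgFamily (avOfRecord F N K) (GaugeField.gaugeAct u U)) (fun _ _ _ => rfl)
    (critLam_meet_gaugeAct_of_critLam_seq Ω hk'k hk' hk D₁ u hUW hcrit)

end Compose

end Summit.QuantumFields.YangMills.BalabanUVNodes.N07CritLamTransferMeet

end
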